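import Literature.MathematicalPhysics.KineticTheory.VelocityBlindPlacement
import Literature.MathematicalPhysics.KineticTheory.CollisionTubePullbackDefs
import HarnessLib

/-!
# Snapshot placement, pool regularity and window collision moments: the six hypotheses of the window transfer to contact chaos

Topic `Literature/MathematicalPhysics/KineticTheory`; companion of `VelocityBlindPlacement.lean` (vocabulary) for the crux line
`Sketch` (idea `velocity-blind-placement`) on `InformationPercolationEngine.PercolationClosesChaos` (stmt-AtomisticToContinuum-14915;
lead `prover-line-stmt-AtomisticToContinuum-14915-0`, skeleton `Summits/…/Cruxes/PercolationClosesChaos/Lines/Sketch.lean`).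
Six OPEN statements (`def … : Prop`, conjecture-style, never asserted) about the deterministic hard-sphere flow on `𝕋³` at fixed
reduced density `σ` under local Gibbs data, all in the quantifier format and the `N → ∞ then r → 0` closure of the route target
`ContactChaos` (stmt-13477), written over the vocabulary `VelocityBlindPlacement.{Flow, closeStat, allStat, maxwellDefect}` and the
pull-back functionals `collisionSum`, `shortFlightDeficit`, `threeBodyCollisionSum` (`EvenCollisionTubeFunctional`,
`CollisionTubePullbackDefs`). They are the hypotheses under which the line's window transfer
(`cylinderPullback_pathwise` + cylinder evaluation + cross-ratio cancellation) yields `ContactChaos`; the transfer, the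
stubs and the composition are problem-side. Bodies byte-identical with the stub worker's typing audit
(`stub_subMeanFreeTimeWindow.report.md` §4, 2026-08-16).

1. `VelocityBlindPairPlacement` (VBP₂) — labels of an `ℓ`-close pair are independent of its geometry and distributed as two
   independent draws from the `r`-pool (order `k = 1`, anchor radius `r²`, pool radius `r`).
2. `NearContactIsotropy` (NCGiso) — the geometry-only anchored pair-separation statistic is invariant under linear isometries of
   `ℝ³` applied to the test.
3. `NearContactValue` (NCGcv) — its radial profile has a contact value (`shellTest`: shell content per unit width is
   asymptotically width-independent).
4. `PoolLocalMaxwellian` (LMP) — the `r`-pool is weakly close to the Maxwellian with its own five moments (`maxwellDefect`).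
5. `PoolTemporalCoherence` (TM) — tent-averaged (width `r`) pool pair functionals equal the instantaneous ones times the tent mass.
6. `WindowCollisionMoments` (WCM) — tight normalised collision count, rare fast collisions, short-flight deficit and three-body
   collision sum `o_a(1)`: the in-probability control of the four remainders of `cylinderPullback_pathwise`.

## References (design sources; the statements are constructions of this programme, tagged `[folklore]`)

* C. Cercignani, R. Illner, M. Pulvirenti, *The Mathematical Theory of Dilute Gases* (1994), §2.3, §4.4 p. 86, App. 4.A. [CIP1994]
* H. Spohn, *Large Scale Dynamics of Interacting Particles* (1991), Part I Ch. 3 (local equilibrium at fixed reduced density). [Spohn1991]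
* O. E. Lanford, *Time evolution of large classical systems* (1975). [Lanford1975]

## Not here

No claim that any of the six holds, no transfer theorem, no composition (all problem-side).
-/

noncomputable section

open MeasureTheory Set
open scoped ENNReal BigOperators
open Literature.Analysis.FluidPDE

namespace Literature.MathematicalPhysics.KineticTheory

namespace VelocityBlindPlacement

/-- The normalised radial shell test of relative width `d` above contact: in the units of `closeStat` (separations rescaled by
`ℓ_N⁻¹`) contact is `‖q‖ = ε_N / ℓ_N = π σ³`; `φ` is a profile on `[0, 1]`. [folklore] -/
def shellTest (σ : ℝ) (φ : ℝ → ℝ) (d : ℝ) (q : V3) : ℝ :=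
  d⁻¹ * φ ((‖q‖ / (Real.pi * σ ^ 3) - 1) / d)

/-- **VBP₂ — velocity-blind PAIR placement, two-scale form.** For continuous positive profiles there is `σ₀ > 0` such that for
`0 < σ < σ₀`, every flow family, horizon `τ > 0`, continuous localiser `χ`, continuous compactly supported geometry test `g` on the
rescaled minimal-image separation and bounded continuous label test `F` on the two velocities, the cross-ratio
`Close_{g,F}(r²)·All_1(r) − Close_{g,1}(r²)·All_F(r)`, time–space integrated against `χ`, tends to `0` in `localGibbsLaw`-probability
as `N → ∞` then `r → 0`: the velocity labels of an `ℓ`-close pair anchored in an `r²`-ball are independent of the pair's geometry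
and distributed as two independent draws from the `r`-pool. Open (Boltzmann-hypothesis class). [folklore] -/
def VelocityBlindPairPlacement : Prop :=
  ∀ (a₀ θ₀ : T3 → ℝ) (u₀ : T3 → V3), Continuous a₀ → Continuous θ₀ → Continuous u₀ →
    (∀ x, 0 < a₀ x) → (∀ x, 0 < θ₀ x) →
    ∃ σ₀ : ℝ, 0 < σ₀ ∧ ∀ σ : ℝ, 0 < σ → σ < σ₀ → ∀ Φ : (N : ℕ) → Flow σ N, ∀ τ : ℝ, 0 < τ →
      ∀ χ : ℝ × T3 → ℝ, Continuous χ → ∀ g : V3 → ℝ, Continuous g → HasCompactSupport g →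
      ∀ F : V3 × V3 → ℝ, Continuous F → (∃ C : ℝ, ∀ p, |F p| ≤ C) →
      ∀ η δ : ℝ, 0 < η → 0 < δ → ∃ r₀ : ℝ, 0 < r₀ ∧ ∀ r : ℝ, 0 < r → r < r₀ → ∃ N₀ : ℕ, ∀ N : ℕ, N₀ ≤ N →
        localGibbsLaw σ a₀ u₀ θ₀ N (Φ N) {z | η < |∫ s in Icc (0 : ℝ) τ, ∫ x₀ : T3, χ (s, x₀) *
          (closeStat 1 (fun q => g (q 0)) (fun v => F (v 0, v 1)) σ (r ^ 2) N ((Φ N).flow s z) x₀ *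
              allStat 1 (fun _ => 1) r N ((Φ N).flow s z) x₀ -
            closeStat 1 (fun q => g (q 0)) (fun _ => 1) σ (r ^ 2) N ((Φ N).flow s z) x₀ *
              allStat 1 (fun v => F (v 0, v 1)) r N ((Φ N).flow s z) x₀)|} ≤ ENNReal.ofReal δ

/-- **NCGiso — statistical isotropy of the near-contact pair geometry.** The geometry-only anchored pair-separation statistic
`Close_{g,1}(r²)` is asymptotically invariant (in probability, time–space integrated) under every linear isometry `R` of `ℝ³`
applied to the test `g`. Open. [folklore] -/
def NearContactIsotropy : Prop :=
  ∀ (a₀ θ₀ : T3 → ℝ) (u₀ : T3 → V3), Continuous a₀ → Continuous θ₀ → Continuous u₀ →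
    (∀ x, 0 < a₀ x) → (∀ x, 0 < θ₀ x) →
    ∃ σ₀ : ℝ, 0 < σ₀ ∧ ∀ σ : ℝ, 0 < σ → σ < σ₀ → ∀ Φ : (N : ℕ) → Flow σ N, ∀ τ : ℝ, 0 < τ →
      ∀ χ : ℝ × T3 → ℝ, Continuous χ → ∀ g : V3 → ℝ, Continuous g → HasCompactSupport g →
      ∀ R : V3 ≃ₗᵢ[ℝ] V3,
      ∀ η δ : ℝ, 0 < η → 0 < δ → ∃ r₀ : ℝ, 0 < r₀ ∧ ∀ r : ℝ, 0 < r → r < r₀ → ∃ N₀ : ℕ, ∀ N : ℕ, N₀ ≤ N →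
        localGibbsLaw σ a₀ u₀ θ₀ N (Φ N) {z | η < |∫ s in Icc (0 : ℝ) τ, ∫ x₀ : T3, χ (s, x₀) *
          (closeStat 1 (fun q => g (q 0)) (fun _ => 1) σ (r ^ 2) N ((Φ N).flow s z) x₀ -
            closeStat 1 (fun q => g (R (q 0))) (fun _ => 1) σ (r ^ 2) N ((Φ N).flow s z) x₀)|} ≤ ENNReal.ofReal δ

/-- **NCGcv — existence of the contact value of the radial pair profile.** The shell content per unit width of the anchored
pair-separation statistic (`shellTest σ φ d`, width `d` above contact) is asymptotically independent of the small width: for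
every profile `φ` supported in `[0, 1]`, widths `d, d' < d₀(η, δ)` give the same statistic up to `η` in probability. Open. [folklore] -/
def NearContactValue : Prop :=
  ∀ (a₀ θ₀ : T3 → ℝ) (u₀ : T3 → V3), Continuous a₀ → Continuous θ₀ → Continuous u₀ →
    (∀ x, 0 < a₀ x) → (∀ x, 0 < θ₀ x) →
    ∃ σ₀ : ℝ, 0 < σ₀ ∧ ∀ σ : ℝ, 0 < σ → σ < σ₀ → ∀ Φ : (N : ℕ) → Flow σ N, ∀ τ : ℝ, 0 < τ →
      ∀ χ : ℝ × T3 → ℝ, Continuous χ → ∀ φ : ℝ → ℝ, Continuous φ → (∀ x, x ∉ Icc (0 : ℝ) 1 → φ x = 0) →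
      ∀ η δ : ℝ, 0 < η → 0 < δ → ∃ d₀ : ℝ, 0 < d₀ ∧ ∀ d d' : ℝ, 0 < d → d < d₀ → 0 < d' → d' < d₀ →
        ∃ r₀ : ℝ, 0 < r₀ ∧ ∀ r : ℝ, 0 < r → r < r₀ → ∃ N₀ : ℕ, ∀ N : ℕ, N₀ ≤ N →
        localGibbsLaw σ a₀ u₀ θ₀ N (Φ N) {z | η < |∫ s in Icc (0 : ℝ) τ, ∫ x₀ : T3, χ (s, x₀) *
          (closeStat 1 (fun q => shellTest σ φ d (q 0)) (fun _ => 1) σ (r ^ 2) N ((Φ N).flow s z) x₀ -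
            closeStat 1 (fun q => shellTest σ φ d' (q 0)) (fun _ => 1) σ (r ^ 2) N ((Φ N).flow s z) x₀)|} ≤
          ENNReal.ofReal δ

/-- **LMP — local Maxwellianity of the `r`-pool in probability.** For bounded continuous velocity observables `F`,
`maxwellDefect F` (the pool tested against `F` minus its own-moment Maxwellian value, time–space integrated against `χ`) tends
to `0` in `localGibbsLaw`-probability as `N → ∞` then `r → 0`. Local equilibrium of the one-body empirical law at resolution
`r` along the deterministic flow — open (Spohn 1991, Part I Ch. 3). [folklore] -/
def PoolLocalMaxwellian : Prop :=
  ∀ (a₀ θ₀ : T3 → ℝ) (u₀ : T3 → V3), Continuous a₀ → Continuous θ₀ → Continuous u₀ →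
    (∀ x, 0 < a₀ x) → (∀ x, 0 < θ₀ x) →
    ∃ σ₀ : ℝ, 0 < σ₀ ∧ ∀ σ : ℝ, 0 < σ → σ < σ₀ → ∀ Φ : (N : ℕ) → Flow σ N, ∀ τ : ℝ, 0 < τ →
      ∀ χ : ℝ × T3 → ℝ, Continuous χ → ∀ F : V3 → ℝ, Continuous F → (∃ C : ℝ, ∀ v, |F v| ≤ C) →
      ∀ η δ : ℝ, 0 < η → 0 < δ → ∃ r₀ : ℝ, 0 < r₀ ∧ ∀ r : ℝ, 0 < r → r < r₀ → ∃ N₀ : ℕ, ∀ N : ℕ, N₀ ≤ N →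
        localGibbsLaw σ a₀ u₀ θ₀ N (Φ N) {z | η < |maxwellDefect F σ τ r N (Φ N) χ z|} ≤ ENNReal.ofReal δ

/-- **TM — temporal coherence of the `r`-pool over lags `≤ r`.** For bounded continuous pair observables `Th`, the tent-averaged
(width `r`, truncated to `[0, τ]`) pool pair functional `All_Th(r)` equals the instantaneous one times the tent mass
`c_r(s) = ∫_{[0,τ]} r⁻¹(1 − |s' − s|/r)₊ ds'`, in `L¹(χ ds dx₀)`-probability as `N → ∞` then `r → 0` (forced by the target's
time-mollified reference; hydrodynamic-regularity class). Open. [folklore] -/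
def PoolTemporalCoherence : Prop :=
  ∀ (a₀ θ₀ : T3 → ℝ) (u₀ : T3 → V3), Continuous a₀ → Continuous θ₀ → Continuous u₀ →
    (∀ x, 0 < a₀ x) → (∀ x, 0 < θ₀ x) →
    ∃ σ₀ : ℝ, 0 < σ₀ ∧ ∀ σ : ℝ, 0 < σ → σ < σ₀ → ∀ Φ : (N : ℕ) → Flow σ N, ∀ τ : ℝ, 0 < τ →
      ∀ χ : ℝ × T3 → ℝ, Continuous χ → ∀ Th : V3 × V3 → ℝ, Continuous Th → (∃ C : ℝ, ∀ p, |Th p| ≤ C) →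
      ∀ η δ : ℝ, 0 < η → 0 < δ → ∃ r₀ : ℝ, 0 < r₀ ∧ ∀ r : ℝ, 0 < r → r < r₀ → ∃ N₀ : ℕ, ∀ N : ℕ, N₀ ≤ N →
        localGibbsLaw σ a₀ u₀ θ₀ N (Φ N) {z | η < |∫ s in Icc (0 : ℝ) τ, ∫ x₀ : T3, χ (s, x₀) *
          ((∫ s' in Icc (0 : ℝ) τ, r⁻¹ * max (1 - |s' - s| / r) 0 *
              allStat 1 (fun v => Th (v 0, v 1)) r N ((Φ N).flow s' z) x₀) -
            (∫ s' in Icc (0 : ℝ) τ, r⁻¹ * max (1 - |s' - s| / r) 0) *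
              allStat 1 (fun v => Th (v 0, v 1)) r N ((Φ N).flow s z) x₀)|} ≤ ENNReal.ofReal δ

/-- **WCM — `N`-uniform window collision moments under `localGibbsLaw`, in probability.** (a) the normalised collision count
`K_N[1]` (`collisionSum … 1 1 1`) is tight; (b) collisions with a fast partner (`max ‖v‖ ‖w‖ ≥ V`) carry a vanishing fraction as
`V → ∞`; (c) the short-flight deficit `shortFlightDeficit` of the tube of length `a ℓ_N` (`κ = a/(πσ³)`) is `o_a(1)` after the
`((N+1)κ)⁻¹` normalisation; (d) the three-body collision sum `threeBodyCollisionSum` with shell parameter `L` is `o_a(1)` after the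
`ε/(N+1)` normalisation — the in-probability control of the four remainders of `cylinderPullback_pathwise`. (a), (b) are second-moment
tightness of the collision functional; (c), (d) are equilibrium short-window estimates moved to local Gibbs data by the entropy
inequality. Open here (standard-in-print class). [folklore] -/
def WindowCollisionMoments : Prop :=
  ∀ (a₀ θ₀ : T3 → ℝ) (u₀ : T3 → V3), Continuous a₀ → Continuous θ₀ → Continuous u₀ →
    (∀ x, 0 < a₀ x) → (∀ x, 0 < θ₀ x) →
    ∃ σ₀ : ℝ, 0 < σ₀ ∧ ∀ σ : ℝ, 0 < σ → σ < σ₀ → ∀ Φ : (N : ℕ) → Flow σ N, ∀ τ : ℝ, 0 < τ →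
      (∀ δ : ℝ, 0 < δ → ∃ M : ℝ, ∃ N₀ : ℕ, ∀ N : ℕ, N₀ ≤ N →
        localGibbsLaw σ a₀ u₀ θ₀ N (Φ N)
          {z | M < Literature.MathematicalPhysics.KineticTheory.collisionSum σ N (Φ N) τ (fun _ => 1) (fun _ => 1)
            (fun _ => 1) 1 z} ≤ ENNReal.ofReal δ) ∧
      (∀ η δ : ℝ, 0 < η → 0 < δ → ∃ V : ℝ, ∃ N₀ : ℕ, ∀ N : ℕ, N₀ ≤ N →
        localGibbsLaw σ a₀ u₀ θ₀ N (Φ N)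
          {z | η < Literature.MathematicalPhysics.KineticTheory.collisionSum σ N (Φ N) τ (fun _ => 1) (fun _ => 1)
            (fun p => max (min (max ‖p.2.1‖ ‖p.2.2‖ - V) 1) 0) 1 z} ≤ ENNReal.ofReal δ) ∧
      (∀ η δ : ℝ, 0 < η → 0 < δ → ∃ a₁ : ℝ, 0 < a₁ ∧ ∀ a : ℝ, 0 < a → a < a₁ → ∃ N₀ : ℕ, ∀ N : ℕ, N₀ ≤ N →
        localGibbsLaw σ a₀ u₀ θ₀ N (Φ N)
          {z | η < ((N + 1 : ℝ) * (a / (Real.pi * σ ^ 3)))⁻¹ *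
            shortFlightDeficit σ N (Φ N) τ (fun _ => 1) (a / (Real.pi * σ ^ 3)) z} ≤ ENNReal.ofReal δ) ∧
      (∀ L η δ : ℝ, 0 < L → 0 < η → 0 < δ → ∃ a₁ : ℝ, 0 < a₁ ∧ ∀ a : ℝ, 0 < a → a < a₁ →
        ∃ N₀ : ℕ, ∀ N : ℕ, N₀ ≤ N →
        localGibbsLaw σ a₀ u₀ θ₀ N (Φ N)
          {z | η < hsDiameter σ N / (N + 1 : ℝ) *
            threeBodyCollisionSum σ N (Φ N) τ L (a / (Real.pi * σ ^ 3)) z} ≤ ENNReal.ofReal δ)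

end VelocityBlindPlacement

end Literature.MathematicalPhysics.KineticTheory

end
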